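import Mathlib
import HarnessLib
import Summits.ValiantsHypothesis.ValiantsHypothesis.Theorems.LacunarySymmetroidMatrixDescartesProductPlusOneSlowKneeCellRateFree
import Summits.ValiantsHypothesis.ValiantsHypothesis.Theorems.LacunarySymmetroidMatrixDescartesProductPlusOneWronskianBudget

/-!
# LINE (A) `product_plus_one` (crux `MatrixDescartes`, stmt-ValiantsHypothesis-18050, V1) — EB2-W in its OWN currency, part 1:
# the WINDOW-ASSEMBLY SHELL, and the RATE-GUARDED SLOW-KNEE BINOMIAL CLASS (`Z₊(W(∏ f_j)) ≤ 3·m + 2`, window-free)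

EB2-W (`Cruxes/MatrixDescartes/Lines/product_plus_one.lean`, def `WronskianBudgetK3`, CONJECTURE/TEXT) asks for ONE global inequality
`Z₊(W(∏_j fewnomial d (a j))) ≤ C·m + C` over every one-change `K = 3` company, `W(P) = P·X(XP′)′ − (XP′)²`, `Z₊` = number of DISTINCT positive
roots.  Every W-cell of record is a PER-WINDOW count (`≤ 2` / `≤ 1` / `= 0` roots of `W(∏ f_j)` strictly between two points `u < v` at which the
rows satisfy a menu), and the located per-window law `min(2N, 2 + 2F)` (B-SHARP3 census) is not summable over the `≤ m + 1` windows as it stands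
(`N` counts ALL knees).  This file is the bookkeeping that turns three-point window cells into EB2-W-shaped theorems, run on the first class where
the sum is already linear (part 2, `…GlobalCellsOneBump`: pole companies with ONE bump row of each kind):

* §1 tools: `exists_window_extension` (a closed interval `[a,b] ⊂ (0,∞)` avoiding a finite set sits inside an open interval `(u,v)`, `0 < u`, whose
  closure still avoids it), `eval_mul_eval_pos_of_no_root` (no root on `[u,v]` ⇒ `0 < f(u)·f(v)`, intermediate value theorem),
  `row_eval_ne_zero_of_free` (no factor of a nonzero product vanishes on a root-free interval).
* §2 ★ THE SHELL, generic: `card_le_mul_card_add_one` (separator count: every `R`-free stretch of `T` has `≤ k` points ⇒ `|T| ≤ k·(|R|+1)`) and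
  `card_posRoots_le_of_window_bound` — for ANY real `P ≠ 0`, `W`, `k`: if every closed root-free (for `P`) interval `[x,z] ⊂ (0,∞)` carries `≤ k` roots of
  `W`, then `Z₊(W) ≤ (k+1)·Z₊(P) + k` (the `≤ Z₊(P)` positive roots of `W` AT roots of `P` added) — the slot for a located per-window law; three-point
  form `card_posRoots_le_of_threePoint` (`k = 2`: no three roots of `W` in a closed root-free interval ⇒ `Z₊(W) ≤ 3·Z₊(P) + 2`), which is what the
  `…_no_three_zeros` cells of record provide.
* §3 ★★ `slowKneeBinomial_wronskian_card_le` — `K = 3`, `d 0 < d 1 < d 2`, EVERY `m`: if every row is a BINOMIAL of ✓ `…SlowKneeCellRateFree`'s menu —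
  slow pair `(d0,d1)` of ANY signs (any number of slow knees and slow poles), a pole on `(d0,d2)`, a pole on `(d1,d2)` when `d1 − d0 ≤ d2 − d1`, a knee on
  `(d1,d2)` when `d2 − d1 ≤ d1 − d0` — then `Z₊(W(∏_j f_j)) ≤ 3·m + 2` (the three-point cell ✓ `slowKneeCellRateFree_wronskian_no_three_zeros` on the
  extended window; `Z₊(∏ f_j) ≤ m` by ✓ `card_posRoots_prod_le_of_oneChange`).  Euler twin `slowKneeBinomial_eulerNumerator_card_le`:
  `Z₊(eulerNumerator d a l₀) ≤ 5·m + 3` at EVERY coupling `l₀` (✓ `card_posRoots_eulerNumerator_le_wronskian_add_of_oneChange`) — the inequality of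
  the floor `OneChangeFloorK3` on this class, both couplings at once.

HONEST FRAMING: helper / bookkeeping + ONE sub-class (binomial companies under a rate guard: no fast-pair knee unless `d2 − d1 ≤ d1 − d0`, no
trinomial row); the located extremal families (B-SHARP2/3: FAST knees between slow poles) are OUTSIDE it; `WronskianBudgetK3` (∃ C for ALL one-change
companies), `OneChangeFloorK3`, `stub_classRowK3`, `stub_eulerBoundK3`, `stub_polyLaw`, `MatrixDescartes` (18050), Conjecture B are NOT proved;
`VP ≠ VNP` is NOT proved.  No definitions, no named facts, no sorry; Mathlib + ✓ lane modules only.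
-/

set_option linter.dupNamespace false

namespace Summit.ValiantsHypothesis.ValiantsHypothesis.Theorems.LacunarySymmetroidMatrixDescartes

namespace ProductPlusOne

open Finset Set Polynomial
open scoped BigOperators Topology Polynomial

/-! ### §1 Window tools -/

/-- A closed interval `[a, b] ⊂ (0,∞)` avoiding a finite set `R` lies inside an OPEN interval `(u, v)`, `0 < u < a ≤ b < v`, whose closure still
avoids `R`. [folklore] -/
theorem exists_window_extension (R : Finset ℝ) {a b : ℝ} (ha : 0 < a) (hab : a ≤ b)
    (hfree : ∀ r ∈ R, ¬ (a ≤ r ∧ r ≤ b)) :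
    ∃ u v : ℝ, 0 < u ∧ u < a ∧ b < v ∧ ∀ r ∈ R, ¬ (u ≤ r ∧ r ≤ v) := by
  classical
  have hclosed : IsClosed ((R : Set ℝ)) := R.finite_toSet.isClosed
  have haR : a ∈ (R : Set ℝ)ᶜ := fun h => hfree a h ⟨le_rfl, hab⟩
  have hbR : b ∈ (R : Set ℝ)ᶜ := fun h => hfree b h ⟨hab, le_rfl⟩
  obtain ⟨εa, hεa, hballa⟩ := Metric.isOpen_iff.1 hclosed.isOpen_compl a haR
  obtain ⟨εb, hεb, hballb⟩ := Metric.isOpen_iff.1 hclosed.isOpen_compl b hbR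
  refine ⟨max (a - εa / 2) (a / 2), b + εb / 2, lt_max_of_lt_right (by positivity), ?_, by linarith, ?_⟩
  · exact max_lt (by linarith) (by linarith)
  · rintro r hr ⟨hur, hrv⟩
    rcases lt_or_ge r a with hra | hra
    · have hdist : dist r a < εa := by
        rw [Real.dist_eq, abs_of_neg (by linarith)]
        have : a - εa / 2 ≤ r := (le_max_left _ _).trans hur
        linarith
      exact hballa hdist hr
    rcases le_or_gt r b with hrb | hrb
    · exact hfree r hr ⟨hra, hrb⟩
    · have hdist : dist r b < εb := by
        rw [Real.dist_eq, abs_of_pos (by linarith)]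
        linarith
      exact hballb hdist hr

/-- A real polynomial with no root on `[u, v]` (`u ≤ v`) has `0 < f(u)·f(v)` (intermediate value theorem). [folklore] -/
theorem eval_mul_eval_pos_of_no_root (f : ℝ[X]) {u v : ℝ} (huv : u ≤ v) (hno : ∀ t ∈ Icc u v, f.eval t ≠ 0) :
    0 < f.eval u * f.eval v := by
  have hcont : ContinuousOn (fun t => f.eval t) (Icc u v) := f.continuous.continuousOn
  have hu0 : f.eval u ≠ 0 := hno u (left_mem_Icc.2 huv)
  have hv0 : f.eval v ≠ 0 := hno v (right_mem_Icc.2 huv)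
  rcases lt_or_gt_of_ne hu0 with hu | hu
  · rcases lt_or_gt_of_ne hv0 with hv | hv
    · exact mul_pos_of_neg_of_neg hu hv
    · exfalso
      obtain ⟨c, hc, hc0⟩ := intermediate_value_Icc huv hcont ⟨hu.le, hv.le⟩
      exact hno c hc hc0
  · rcases lt_or_gt_of_ne hv0 with hv | hv
    · exfalso
      obtain ⟨c, hc, hc0⟩ := intermediate_value_Icc' huv hcont ⟨hv.le, hu.le⟩
      exact hno c hc hc0
    · exact mul_pos hu hv

/-- If `[u, v] ⊂ (0, ∞)` avoids the positive roots of a nonzero product `∏_j f_j`, no factor vanishes on `[u, v]`. [folklore] -/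
theorem row_eval_ne_zero_of_free {m : ℕ} (f : Fin m → ℝ[X]) (hP : (∏ j, f j) ≠ 0) {u v : ℝ} (hu : 0 < u)
    (hfree : ∀ r ∈ (∏ j, f j).roots.toFinset.filter (fun t => 0 < t), ¬ (u ≤ r ∧ r ≤ v)) (j : Fin m) :
    ∀ t ∈ Icc u v, (f j).eval t ≠ 0 := by
  classical
  intro t ht h0
  have hPt : (∏ i, f i).eval t = 0 := by
    rw [eval_prod]
    exact Finset.prod_eq_zero (Finset.mem_univ j) h0
  refine hfree t ?_ ⟨ht.1, ht.2⟩
  rw [Finset.mem_filter, Multiset.mem_toFinset, mem_roots hP]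
  exact ⟨hPt, hu.trans_le ht.1⟩

/-! ### §2 The window-assembly shell -/

/-- **Generic separator count.** `T, R` finite sets of reals with `T` disjoint from `R`: if every stretch of `T` between two of its points with
no point of `R` strictly inside has at most `k` points, then `|T| ≤ k·(|R| + 1)` (induction on `R` from its maximum; the `k = 2` instance is
✓ `card_le_two_mul_card_add_two`). [folklore] -/
theorem card_le_mul_card_add_one (k : ℕ) (T R : Finset ℝ) (hdisj : ∀ t ∈ T, t ∉ R)
    (hk : ∀ x ∈ T, ∀ z ∈ T, x ≤ z → (∀ r ∈ R, ¬ (x < r ∧ r < z)) →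
      (T.filter (fun t => x ≤ t ∧ t ≤ z)).card ≤ k) :
    T.card ≤ k * (R.card + 1) := by
  classical
  induction R using Finset.induction_on_max generalizing T with
  | empty =>
    rw [Finset.card_empty, zero_add, mul_one]
    rcases T.eq_empty_or_nonempty with hT | hT
    · rw [hT, Finset.card_empty]; exact Nat.zero_le _
    · have hsub : T ⊆ T.filter (fun t => T.min' hT ≤ t ∧ t ≤ T.max' hT) := fun t ht =>
        Finset.mem_filter.2 ⟨ht, T.min'_le t ht, T.le_max' t ht⟩
      exact (Finset.card_le_card hsub).trans
        (hk _ (T.min'_mem hT) _ (T.max'_mem hT) (T.min'_le _ (T.max'_mem hT)) (fun r hr => absurd hr (Finset.notMem_empty r)))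
  | insert a S hS ih =>
    have haS : a ∉ S := fun ha => lt_irrefl a (hS a ha)
    rw [Finset.card_insert_of_notMem haS]
    have hsplit := Finset.card_filter_add_card_filter_not (s := T) (fun t : ℝ => t < a)
    have hlo : (T.filter (fun t => t < a)).card ≤ k * (S.card + 1) := by
      refine ih (T.filter (fun t => t < a))
        (fun t ht htS => hdisj t (Finset.mem_of_mem_filter t ht) (Finset.mem_insert_of_mem htS)) ?_
      intro x hx z hz hxz hno
      have hxT := (Finset.mem_filter.1 hx).1
      have hzT := (Finset.mem_filter.1 hz).1
      have hza : z < a := (Finset.mem_filter.1 hz).2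
      have hno' : ∀ r ∈ insert a S, ¬ (x < r ∧ r < z) := by
        intro r hr hrI
        rcases Finset.mem_insert.1 hr with rfl | hrS
        · exact lt_irrefl _ (hrI.2.trans hza)
        · exact hno r hrS hrI
      refine le_trans (Finset.card_le_card ?_) (hk x hxT z hzT hxz hno')
      intro t ht
      rw [Finset.mem_filter] at ht ⊢
      exact ⟨(Finset.mem_filter.1 ht.1).1, ht.2⟩
    have hhi : (T.filter (fun t => ¬ t < a)).card ≤ k := by
      set T₂ := T.filter (fun t => ¬ t < a) with hT₂
      rcases T₂.eq_empty_or_nonempty with h0 | hne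
      · rw [h0, Finset.card_empty]; exact Nat.zero_le _
      have hx := T₂.min'_mem hne
      have hz := T₂.max'_mem hne
      have hxT := (Finset.mem_filter.1 hx).1
      have hzT := (Finset.mem_filter.1 hz).1
      have hax : a < T₂.min' hne := by
        rcases lt_or_eq_of_le (not_lt.1 (Finset.mem_filter.1 hx).2) with h | h
        · exact h
        · exfalso
          apply hdisj _ hxT
          rw [← h]
          exact Finset.mem_insert_self a S
      have hno : ∀ r ∈ insert a S, ¬ (T₂.min' hne < r ∧ r < T₂.max' hne) := by
        intro r hr hrI
        have hra : r ≤ a := by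
          rcases Finset.mem_insert.1 hr with rfl | hrS
          · exact le_rfl
          · exact (hS r hrS).le
        exact lt_irrefl _ ((hax.trans hrI.1).trans_le hra)
      refine le_trans (Finset.card_le_card ?_) (hk _ hxT _ hzT (T₂.min'_le _ hz) hno)
      intro t ht
      exact Finset.mem_filter.2 ⟨(Finset.mem_filter.1 ht).1, T₂.min'_le t ht, T₂.le_max' t ht⟩
    calc T.card = (T.filter (fun t => t < a)).card + (T.filter (fun t => ¬ t < a)).card := hsplit.symm
      _ ≤ k * (S.card + 1) + k := add_le_add hlo hhi
      _ = k * (S.card + 1 + 1) := by ring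

/-- ★ **THE WINDOW-ASSEMBLY SHELL, generic per-window bound** (W-currency bookkeeping, for the located per-window laws to plug in): let `P ≠ 0` and
`W` be real polynomials such that every closed interval `[x, z] ⊂ (0, ∞)` free of roots of `P` carries at most `k` roots of `W`.  Then
`Z₊(W) ≤ (k + 1)·Z₊(P) + k`: the positive roots of `W` off the roots of `P` are at most `k·(Z₊(P) + 1)` by the separator count
`card_le_mul_card_add_one`, and at most `Z₊(P)` positive roots of `W` are roots of `P`. [this file's theorem] -/
theorem card_posRoots_le_of_window_bound (P W : ℝ[X]) (hP : P ≠ 0) (k : ℕ)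
    (hk : ∀ x z : ℝ, 0 < x → x ≤ z → (∀ t ∈ Icc x z, P.eval t ≠ 0) →
      (W.roots.toFinset.filter (fun t => x ≤ t ∧ t ≤ z)).card ≤ k) :
    (W.roots.toFinset.filter (fun t => 0 < t)).card ≤ (k + 1) * (P.roots.toFinset.filter (fun t => 0 < t)).card + k := by
  classical
  set ZP := P.roots.toFinset.filter (fun t => 0 < t) with hZP
  set ZW := W.roots.toFinset.filter (fun t => 0 < t) with hZW
  by_cases hW : W = 0
  · have : ZW = ∅ := by rw [hZW, hW, roots_zero, Multiset.toFinset_zero, Finset.filter_empty]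
    rw [this, Finset.card_empty]; exact Nat.zero_le _
  set T := ZW.filter (fun t => t ∉ ZP) with hT
  have hmemZW : ∀ {t}, t ∈ ZW ↔ W.eval t = 0 ∧ 0 < t := by
    intro t
    rw [hZW, Finset.mem_filter, Multiset.mem_toFinset, mem_roots hW]
    exact Iff.rfl
  have hmemZP : ∀ {t}, t ∈ ZP ↔ P.eval t = 0 ∧ 0 < t := by
    intro t
    rw [hZP, Finset.mem_filter, Multiset.mem_toFinset, mem_roots hP]
    exact Iff.rfl
  have hTcard : T.card ≤ k * (ZP.card + 1) := by
    refine card_le_mul_card_add_one k T ZP (fun t ht => (Finset.mem_filter.1 ht).2) ?_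
    intro x hx z hz hxz hno
    have hx' := Finset.mem_filter.1 hx
    have hz' := Finset.mem_filter.1 hz
    have hxW := hmemZW.1 hx'.1
    have hfree : ∀ t ∈ Icc x z, P.eval t ≠ 0 := by
      intro t ht hPt
      have htZP : t ∈ ZP := hmemZP.2 ⟨hPt, hxW.2.trans_le ht.1⟩
      rcases eq_or_lt_of_le ht.1 with hxt | hxt
      · exact hx'.2 (hxt ▸ htZP)
      rcases eq_or_lt_of_le ht.2 with htz | htz
      · exact hz'.2 (htz ▸ htZP)
      · exact hno t htZP ⟨hxt, htz⟩
    refine le_trans (Finset.card_le_card fun t ht => ?_) (hk x z hxW.2 hxz hfree)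
    rw [Finset.mem_filter] at ht ⊢
    exact ⟨(Finset.mem_filter.1 (Finset.mem_filter.1 ht.1).1).1, ht.2⟩
  have hcover : ZW ⊆ T ∪ ZP := by
    intro t ht
    by_cases htP : t ∈ ZP
    · exact Finset.mem_union_right _ htP
    · exact Finset.mem_union_left _ (Finset.mem_filter.2 ⟨ht, htP⟩)
  calc ZW.card ≤ (T ∪ ZP).card := Finset.card_le_card hcover
    _ ≤ T.card + ZP.card := Finset.card_union_le _ _
    _ ≤ k * (ZP.card + 1) + ZP.card := by omega
    _ = (k + 1) * ZP.card + k := by ring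

/-- ★ **THE WINDOW-ASSEMBLY SHELL, three-point form** (what every `…_no_three_zeros` cell of the line provides): let `P ≠ 0` and `W` be real
polynomials such that no three positive roots `x₁ < x₂ < x₃` of `W` have the closed interval `[x₁, x₃]` free of roots of `P`.  Then
`Z₊(W) ≤ 3·Z₊(P) + 2` (`card_posRoots_le_of_window_bound` with `k = 2`). [this file's theorem] -/
theorem card_posRoots_le_of_threePoint (P W : ℝ[X]) (hP : P ≠ 0)
    (h3 : ∀ x₁ x₂ x₃ : ℝ, 0 < x₁ → x₁ < x₂ → x₂ < x₃ → W.eval x₁ = 0 → W.eval x₂ = 0 → W.eval x₃ = 0 →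
      (∀ t ∈ Icc x₁ x₃, P.eval t ≠ 0) → False) :
    (W.roots.toFinset.filter (fun t => 0 < t)).card ≤ 3 * (P.roots.toFinset.filter (fun t => 0 < t)).card + 2 := by
  classical
  by_cases hW : W = 0
  · rw [hW, roots_zero, Multiset.toFinset_zero, Finset.filter_empty, Finset.card_empty]; exact Nat.zero_le _
  have h := card_posRoots_le_of_window_bound P W hP 2 (fun x z hx hxz hfree => ?_)
  · simpa using h
  by_contra hgt
  push Not at hgt
  obtain ⟨y₁, hy₁, y₂, hy₂, y₃, hy₃, h12, h23⟩ := exists_three_lt_of_card (T := W.roots.toFinset.filter (fun t => x ≤ t ∧ t ≤ z)) hgt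
  rw [Finset.mem_filter, Multiset.mem_toFinset, mem_roots hW] at hy₁ hy₂ hy₃
  exact h3 y₁ y₂ y₃ (hx.trans_le hy₁.2.1) h12 h23 hy₁.1 hy₂.1 hy₃.1
    (fun t ht => hfree t ⟨hy₁.2.1.trans ht.1, ht.2.trans hy₃.2.2⟩)

/-! ### §3 The rate-guarded slow-knee binomial class (`K = 3`) -/

section Classes

variable {m : ℕ} (d : Fin 3 → ℕ) (a : Fin m → Fin 3 → ℝ)

/-- A zero letter kills the strict dip `b₀b₁ < 0 ∧ b₁b₂ < 0` (so binomial rows are one-change rows). [folklore] -/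
theorem not_dip_of_zero_letter {b : Fin 3 → ℝ} (h : b 0 = 0 ∨ b 1 = 0 ∨ b 2 = 0) : ¬ (b 0 * b 1 < 0 ∧ b 1 * b 2 < 0) := by
  rintro ⟨h01, h12⟩
  rcases h with h | h | h
  · rw [h, zero_mul] at h01; exact lt_irrefl _ h01
  · rw [h, mul_zero] at h01; exact lt_irrefl _ h01
  · rw [h, mul_zero] at h12; exact lt_irrefl _ h12

/-- The company log-Wronskian of the zero product is zero, so it has no positive roots to count. [folklore] -/
theorem wronskian_card_eq_zero_of_prod_eq_zero (hP : (∏ j, ∑ l, C (a j l) * X ^ (d l) : ℝ[X]) = 0) :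
    (((∏ j, ∑ l, C (a j l) * X ^ (d l) : ℝ[X]) * (X * derivative (X * derivative (∏ j, ∑ l, C (a j l) * X ^ (d l) : ℝ[X])))
        - (X * derivative (∏ j, ∑ l, C (a j l) * X ^ (d l) : ℝ[X])) ^ 2).roots.toFinset.filter (fun t => 0 < t)).card = 0 := by
  rw [hP]; simp

/-- The rows of the rate-guarded slow-knee binomial class are one-change rows (a letter vanishes). [folklore] -/
theorem slowKneeBinomial_oneChange
    (hrow : ∀ j, (a j 2 = 0 ∧ a j 0 ≠ 0 ∧ a j 1 ≠ 0) ∨ (a j 1 = 0 ∧ a j 0 * a j 2 < 0) ∨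
      (a j 0 = 0 ∧ a j 1 * a j 2 < 0 ∧ d 1 - d 0 ≤ d 2 - d 1) ∨ (a j 0 = 0 ∧ 0 < a j 1 * a j 2 ∧ d 2 - d 1 ≤ d 1 - d 0)) :
    ∀ j, ¬ (a j 0 * a j 1 < 0 ∧ a j 1 * a j 2 < 0) := by
  intro j
  rcases hrow j with h | h | h | h
  · exact not_dip_of_zero_letter (Or.inr (Or.inr h.1))
  · exact not_dip_of_zero_letter (Or.inr (Or.inl h.1))
  · exact not_dip_of_zero_letter (Or.inl h.1)
  · exact not_dip_of_zero_letter (Or.inl h.1)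

/-- ★★ **EB2-W ON THE RATE-GUARDED SLOW-KNEE BINOMIAL CLASS** (`K = 3`, `d 0 < d 1 < d 2`, every `m`, window-free): if every row is a binomial on
the slow pair `(d0, d1)` of ANY signs, a pole on `(d0, d2)`, a pole on `(d1, d2)` with `d1 − d0 ≤ d2 − d1`, or a knee on `(d1, d2)` with
`d2 − d1 ≤ d1 − d0` (the binomial rows of ✓ `…SlowKneeCellRateFree`'s menu — any number of knees), then
`Z₊(W(∏_j f_j)) ≤ 3·m + 2`. [this file's theorem] -/
theorem slowKneeBinomial_wronskian_card_le (h01 : d 0 < d 1) (h12 : d 1 < d 2)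
    (hrow : ∀ j, (a j 2 = 0 ∧ a j 0 ≠ 0 ∧ a j 1 ≠ 0) ∨ (a j 1 = 0 ∧ a j 0 * a j 2 < 0) ∨
      (a j 0 = 0 ∧ a j 1 * a j 2 < 0 ∧ d 1 - d 0 ≤ d 2 - d 1) ∨ (a j 0 = 0 ∧ 0 < a j 1 * a j 2 ∧ d 2 - d 1 ≤ d 1 - d 0)) :
    (((∏ j, ∑ l, C (a j l) * X ^ (d l) : ℝ[X]) * (X * derivative (X * derivative (∏ j, ∑ l, C (a j l) * X ^ (d l) : ℝ[X])))
        - (X * derivative (∏ j, ∑ l, C (a j l) * X ^ (d l) : ℝ[X])) ^ 2).roots.toFinset.filter (fun t => 0 < t)).card ≤ 3 * m + 2 := by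
  classical
  set P : ℝ[X] := ∏ j, ∑ l, C (a j l) * X ^ (d l) with hPdef
  by_cases hP : P = 0
  · rw [wronskian_card_eq_zero_of_prod_eq_zero d a hP]; exact Nat.zero_le _
  rcases Nat.eq_zero_or_pos m with hm0 | hm
  · subst hm0
    have h1 : P = 1 := by rw [hPdef]; simp
    rw [h1]; simp
  have hone := slowKneeBinomial_oneChange d a hrow
  have hZP : (P.roots.toFinset.filter (fun t => 0 < t)).card ≤ m := by
    rw [hPdef]; exact card_posRoots_prod_le_of_oneChange d h01 h12 a hone
  refine (card_posRoots_le_of_threePoint P _ hP ?_).trans (by omega)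
  intro x₁ x₂ x₃ hx₁ h12' h23 hW₁ hW₂ hW₃ hfreeI
  -- extend `[x₁, x₃]` to an open root-free window `(u, v)` with `0 < u`
  have hfree' : ∀ r ∈ P.roots.toFinset.filter (fun t => 0 < t), ¬ (x₁ ≤ r ∧ r ≤ x₃) := by
    intro r hr hrI
    rw [Finset.mem_filter, Multiset.mem_toFinset, mem_roots hP] at hr
    exact hfreeI r ⟨hrI.1, hrI.2⟩ hr.1
  obtain ⟨u, v, hu, hux, hxv, hfree⟩ := exists_window_extension _ hx₁ (h12'.trans h23).le hfree'
  have hrowfree := row_eval_ne_zero_of_free (fun j => (∑ l, C (a j l) * X ^ (d l) : ℝ[X])) hP hu hfree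
  have hsign : ∀ j, 0 ≤ (∑ l, C (a j l) * X ^ (d l) : ℝ[X]).eval u * (∑ l, C (a j l) * X ^ (d l) : ℝ[X]).eval v := fun j =>
    (eval_mul_eval_pos_of_no_root _ (by linarith) (hrowfree j)).le
  refine slowKneeCellRateFree_wronskian_no_three_zeros hm d h01 h12 a hu (fun j => ?_) (x₁ := x₁) (x₂ := x₂) (x₃ := x₃)
    ⟨hux, by linarith⟩ ⟨by linarith, hxv⟩ h12' h23 ?_
  · rcases hrow j with h | h | h | h
    · exact Or.inl ⟨h.1, h.2.1, h.2.2, hsign j⟩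
    · exact Or.inr (Or.inl ⟨h.1, h.2, hsign j⟩)
    · exact Or.inr (Or.inr (Or.inl ⟨h.1, h.2.1, h.2.2, hsign j⟩))
    · exact Or.inr (Or.inr (Or.inr (Or.inl ⟨h.1, h.2.1, h.2.2⟩)))
  · intro x hx
    simp only [Set.mem_insert_iff, Set.mem_singleton_iff] at hx
    rcases hx with rfl | rfl | rfl
    · exact hW₁
    · exact hW₂
    · exact hW₃


/-- **Floor inequality on the rate-guarded slow-knee binomial class**: `Z₊(eulerNumerator d a l₀) ≤ 5·m + 3` for every coupling `l₀`
(✓ `card_posRoots_eulerNumerator_le_wronskian_add_of_oneChange` + `slowKneeBinomial_wronskian_card_le`). [this file's theorem] -/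
theorem slowKneeBinomial_eulerNumerator_card_le (h01 : d 0 < d 1) (h12 : d 1 < d 2)
    (hrow : ∀ j, (a j 2 = 0 ∧ a j 0 ≠ 0 ∧ a j 1 ≠ 0) ∨ (a j 1 = 0 ∧ a j 0 * a j 2 < 0) ∨
      (a j 0 = 0 ∧ a j 1 * a j 2 < 0 ∧ d 1 - d 0 ≤ d 2 - d 1) ∨ (a j 0 = 0 ∧ 0 < a j 1 * a j 2 ∧ d 2 - d 1 ≤ d 1 - d 0))
    (l₀ : Fin 3) :
    ((∑ j, (∑ l, C (a j l * ((d l : ℝ) - d l₀)) * X ^ (d l)) * ∏ i ∈ Finset.univ.erase j, (∑ l, C (a i l) * X ^ (d l))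
        : ℝ[X]).roots.toFinset.filter (fun t => 0 < t)).card ≤ 5 * m + 3 := by
  have h1 := card_posRoots_eulerNumerator_le_wronskian_add_of_oneChange d h01 h12 a (slowKneeBinomial_oneChange d a hrow) l₀
  have h2 := slowKneeBinomial_wronskian_card_le d a h01 h12 hrow
  omega

end Classes

end ProductPlusOne

end Summit.ValiantsHypothesis.ValiantsHypothesis.Theorems.LacunarySymmetroidMatrixDescartes
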